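import Mathlib.Analysis.InnerProductSpace.PiL2
import Mathlib.Analysis.InnerProductSpace.Projection.FiniteDimensional
import HarnessLib

/-!
# Star sharing of exact clusters: three unit spheres with centres on a unit «V» meet in at most two points

HONEST FRAMING. Venture `Summits/Ventures/Crystal3D` (cell `crystal3d-full`), helper `--supports` the crux `CoaxialWallLaw`
(stmt-Ventures-19481) of `route-Ventures-StickyWulffConstant`, lane F 'Certificates' (T5b, multi-piece split of the seam side,
cf-p1 rulings (ccxl)/(ccxliii)(C)/(ccxlv)(D): footprint packing + OVERLAP lemma).  This file is the one OVERLAP ingredient that is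
true for every pair of exact readers (FULL or TWIN dozens alike) — the bound `s₁₂ ≤ 2` on SHARED STAR BALLS:

* `inner_eq_half_of_unit_triangle` — `dist p x = dist q x = dist p q = 1 ⇒ ⟪p − x, q − x⟫ = ½`;
* `three_unit_spheres_subsingleton₃` — if `q₁ ≠ q₂` both touch `x`, then among any three points each touching `x`, `q₁` and `q₂`
  two coincide (the three spheres `S(x,1) ∩ S(q₁,1) ∩ S(q₂,1)` hold at most two points; dimension count in `(EuclideanSpace ℝ (Fin 3))`:
  `(ℝu ⊔ ℝv)ᗮ` is a line when `u = q₁ − x`, `v = q₂ − x` are independent, and the antipodal case `v = −u` is empty);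
* `card_touching_three_le_two` — Finset form;
* `card_common_star_le_two` — CLUSTER FORM: in any configuration `X`, two distinct balls `q₁, q₂` touching a ball `x` have at most two
  common contacts among the contacts of `x`: `#{p ∈ X : dist x p = 1 ∧ dist q₁ p = 1 ∧ dist q₂ p = 1} ≤ 2`.  For two EXACT
  13-clusters `{qᵢ} ∪ D(qᵢ)` through a common dozen ball `x` with non-adjacent centres this is «the 5-stars at `x` share at most two
  balls» (memo STARSHARE-g19.md on the item: `= 2` occurs, e.g. the hcp–hcp shared-square pair at `|q₁ q₂| = √2`).

WHAT THIS IS NOT: not the overlap lemma «≤ 2 pieces per ball» (FALSE once twin readers are admitted — memo STARSHARE-g19.md,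
kit j334021/j334124), not a stub closure; F-C1 not moved; the 3D crystallization summit is not claimed.
-/

noncomputable section

namespace Summit.Ventures.Crystal3D.Theorems

namespace StarSharing

open Module
open scoped InnerProductSpace

/-- In a unit triangle `p, q, x` the edge vectors at `x` have inner product `½`. -/
theorem inner_eq_half_of_unit_triangle {p q x : (EuclideanSpace ℝ (Fin 3))} (hpx : dist p x = 1) (hqx : dist q x = 1) (hpq : dist p q = 1) :
    ⟪p - x, q - x⟫_ℝ = 1 / 2 := by
  have h1 : ‖p - x‖ = 1 := by rwa [← dist_eq_norm]
  have h2 : ‖q - x‖ = 1 := by rwa [← dist_eq_norm]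
  have h3 : ‖(p - x) - (q - x)‖ = 1 := by rw [show (p - x) - (q - x) = p - q by abel, ← dist_eq_norm]; exact hpq
  have h4 : ‖(p - x) - (q - x)‖ ^ 2 = ‖p - x‖ ^ 2 - 2 * ⟪p - x, q - x⟫_ℝ + ‖q - x‖ ^ 2 := norm_sub_sq_real _ _
  rw [h1, h2, h3] at h4
  linarith

/-- **Three unit spheres whose centres `x, q₁, q₂` satisfy `dist x q₁ = dist x q₂ = 1`, `q₁ ≠ q₂`, meet in at most two points**:
among three points each at distance `1` from `x`, `q₁` and `q₂`, two are equal. -/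
theorem three_unit_spheres_subsingleton₃ {x q₁ q₂ p₁ p₂ p₃ : (EuclideanSpace ℝ (Fin 3))} (hq₁ : dist q₁ x = 1) (hq₂ : dist q₂ x = 1) (hne : q₁ ≠ q₂)
    (h₁x : dist p₁ x = 1) (h₁a : dist p₁ q₁ = 1) (h₁b : dist p₁ q₂ = 1)
    (h₂x : dist p₂ x = 1) (h₂a : dist p₂ q₁ = 1) (h₂b : dist p₂ q₂ = 1)
    (h₃x : dist p₃ x = 1) (h₃a : dist p₃ q₁ = 1) (h₃b : dist p₃ q₂ = 1) :
    p₁ = p₂ ∨ p₁ = p₃ ∨ p₂ = p₃ := by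
  set u : (EuclideanSpace ℝ (Fin 3)) := q₁ - x with hu
  set v : (EuclideanSpace ℝ (Fin 3)) := q₂ - x with hv
  have hu1 : ‖u‖ = 1 := by rw [hu, ← dist_eq_norm]; exact hq₁
  have hv1 : ‖v‖ = 1 := by rw [hv, ← dist_eq_norm]; exact hq₂
  have hu0 : u ≠ 0 := by intro h; rw [h, norm_zero] at hu1; norm_num at hu1
  have hv0 : v ≠ 0 := by intro h; rw [h, norm_zero] at hv1; norm_num at hv1
  -- every common point sees `u` and `v` at inner product ½
  have i₁u : ⟪p₁ - x, u⟫_ℝ = 1 / 2 := inner_eq_half_of_unit_triangle h₁x hq₁ h₁a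
  have i₁v : ⟪p₁ - x, v⟫_ℝ = 1 / 2 := inner_eq_half_of_unit_triangle h₁x hq₂ h₁b
  have i₂u : ⟪p₂ - x, u⟫_ℝ = 1 / 2 := inner_eq_half_of_unit_triangle h₂x hq₁ h₂a
  have i₂v : ⟪p₂ - x, v⟫_ℝ = 1 / 2 := inner_eq_half_of_unit_triangle h₂x hq₂ h₂b
  have i₃u : ⟪p₃ - x, u⟫_ℝ = 1 / 2 := inner_eq_half_of_unit_triangle h₃x hq₁ h₃a
  have i₃v : ⟪p₃ - x, v⟫_ℝ = 1 / 2 := inner_eq_half_of_unit_triangle h₃x hq₂ h₃b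
  -- the plane `K = ℝu ⊔ ℝv` and its dimension
  set K : Submodule ℝ (EuclideanSpace ℝ (Fin 3)) := (ℝ ∙ u) ⊔ (ℝ ∙ v) with hK
  have hE : finrank ℝ (EuclideanSpace ℝ (Fin 3)) = 3 := by simp
  have hK2 : finrank ℝ K ≤ 2 := by
    have h := Submodule.finrank_add_le_finrank_add_finrank (ℝ ∙ u) (ℝ ∙ v)
    rw [finrank_span_singleton hu0, finrank_span_singleton hv0] at h
    exact h
  have hK1 : 1 ≤ finrank ℝ K := by
    have h := Submodule.finrank_mono (le_sup_left : (ℝ ∙ u) ≤ K)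
    rwa [finrank_span_singleton hu0] at h
  have hsum := Submodule.finrank_add_finrank_orthogonal K
  by_cases hK1' : finrank ℝ K = 1
  · -- degenerate: `v ∈ ℝ u`, so `v = ± u`; `v = u` contradicts `q₁ ≠ q₂`, `v = −u` contradicts the two inner products ½
    exfalso
    have hKu : (ℝ ∙ u) = K :=
      Submodule.eq_of_le_of_finrank_eq le_sup_left (by rw [finrank_span_singleton hu0, hK1'])
    have hvK : v ∈ (ℝ ∙ u) := by rw [hKu]; exact Submodule.mem_sup_right (Submodule.mem_span_singleton_self v)
    obtain ⟨c, hc⟩ := Submodule.mem_span_singleton.1 hvK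
    have hc1 : c * c = 1 := by
      have h : ‖v‖ = |c| * ‖u‖ := by rw [← hc, norm_smul, Real.norm_eq_abs]
      rw [hv1, hu1, mul_one] at h
      nlinarith [sq_abs c, h]
    have hiv : ⟪p₁ - x, v⟫_ℝ = c * ⟪p₁ - x, u⟫_ℝ := by rw [← hc, real_inner_smul_right]
    rw [i₁v, i₁u] at hiv
    have hc' : c = 1 := by linarith
    apply hne
    have : v = u := by rw [← hc, hc', one_smul]
    have h' : q₂ - x = q₁ - x := this
    exact (sub_left_inj.1 h').symm
  · -- generic: `Kᗮ` is a line containing `p₂ − p₁` and `p₃ − p₁`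
    have hK2' : finrank ℝ K = 2 := by omega
    have hKo : finrank ℝ Kᗮ = 1 := by omega
    have memo : ∀ w : (EuclideanSpace ℝ (Fin 3)), ⟪w, u⟫_ℝ = 0 → ⟪w, v⟫_ℝ = 0 → w ∈ Kᗮ := by
      intro w hwu hwv
      rw [hK, ← Submodule.inf_orthogonal]
      refine Submodule.mem_inf.2 ⟨?_, ?_⟩
      · rw [Submodule.mem_orthogonal_singleton_iff_inner_right, real_inner_comm]; exact hwu
      · rw [Submodule.mem_orthogonal_singleton_iff_inner_right, real_inner_comm]; exact hwv
    set a : (EuclideanSpace ℝ (Fin 3)) := p₂ - p₁ with ha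
    set b : (EuclideanSpace ℝ (Fin 3)) := p₃ - p₁ with hb
    have hau : ⟪a, u⟫_ℝ = 0 := by rw [ha, show p₂ - p₁ = (p₂ - x) - (p₁ - x) by abel, inner_sub_left, i₂u, i₁u]; ring
    have hav : ⟪a, v⟫_ℝ = 0 := by rw [ha, show p₂ - p₁ = (p₂ - x) - (p₁ - x) by abel, inner_sub_left, i₂v, i₁v]; ring
    have hbu : ⟪b, u⟫_ℝ = 0 := by rw [hb, show p₃ - p₁ = (p₃ - x) - (p₁ - x) by abel, inner_sub_left, i₃u, i₁u]; ring
    have hbv : ⟪b, v⟫_ℝ = 0 := by rw [hb, show p₃ - p₁ = (p₃ - x) - (p₁ - x) by abel, inner_sub_left, i₃v, i₁v]; ring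
    have haK : a ∈ Kᗮ := memo a hau hav
    have hbK : b ∈ Kᗮ := memo b hbu hbv
    by_cases h12 : p₁ = p₂
    · exact Or.inl h12
    have ha0 : a ≠ 0 := by rw [ha]; exact sub_ne_zero.2 (Ne.symm h12)
    have ha0' : (⟨a, haK⟩ : Kᗮ) ≠ 0 := by
      intro h; apply ha0; exact congrArg Subtype.val h
    obtain ⟨c, hc⟩ := (finrank_eq_one_iff_of_nonzero' (⟨a, haK⟩ : Kᗮ) ha0').1 hKo ⟨b, hbK⟩
    have hcab : c • a = b := by
      have := congrArg Subtype.val hc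
      simpa using this
    -- metric part: `w = p₁ − x`, `‖w‖ = ‖w + a‖ = ‖w + c a‖ = 1` forces `c = 0` or `c = 1`
    set w : (EuclideanSpace ℝ (Fin 3)) := p₁ - x with hw
    have hw1 : ‖w‖ = 1 := by rw [hw, ← dist_eq_norm]; exact h₁x
    have hwa : ‖w + a‖ = 1 := by rw [hw, ha, show p₁ - x + (p₂ - p₁) = p₂ - x by abel, ← dist_eq_norm]; exact h₂x
    have hwb : ‖w + c • a‖ = 1 := by rw [hcab, hw, hb, show p₁ - x + (p₃ - p₁) = p₃ - x by abel, ← dist_eq_norm]; exact h₃x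
    have e1 : ‖w + a‖ ^ 2 = ‖w‖ ^ 2 + 2 * ⟪w, a⟫_ℝ + ‖a‖ ^ 2 := norm_add_sq_real _ _
    have e2 : ‖w + c • a‖ ^ 2 = ‖w‖ ^ 2 + 2 * ⟪w, c • a⟫_ℝ + ‖c • a‖ ^ 2 := norm_add_sq_real _ _
    rw [real_inner_smul_right, norm_smul, mul_pow, Real.norm_eq_abs, sq_abs] at e2
    rw [hwa, hw1] at e1
    rw [hwb, hw1] at e2
    have hA : 0 < ‖a‖ ^ 2 := by positivity
    have hc01 : c = 0 ∨ c = 1 := by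
      have h : ‖a‖ ^ 2 * (c * (c - 1)) = 0 := by linear_combination c * e1 - e2
      rcases mul_eq_zero.1 h with h | h
      · exact absurd h hA.ne'
      · rcases mul_eq_zero.1 h with h | h
        · exact Or.inl h
        · exact Or.inr (by linarith)
    rcases hc01 with h0 | h1
    · -- `b = 0`: `p₃ = p₁`
      right; left
      have : b = 0 := by rw [← hcab, h0, zero_smul]
      rw [hb] at this
      exact (sub_eq_zero.1 this).symm
    · -- `b = a`: `p₃ = p₂`
      right; right
      have : b = a := by rw [← hcab, h1, one_smul]
      rw [hb, ha] at this
      exact (sub_left_inj.1 this).symm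

/-- **Finset form**: a set of points each touching `x`, `q₁`, `q₂` (`q₁ ≠ q₂` both touching `x`) has at most two elements. -/
theorem card_touching_three_le_two {x q₁ q₂ : (EuclideanSpace ℝ (Fin 3))} (hq₁ : dist q₁ x = 1) (hq₂ : dist q₂ x = 1) (hne : q₁ ≠ q₂)
    (T : Finset (EuclideanSpace ℝ (Fin 3))) (hT : ∀ p ∈ T, dist p x = 1 ∧ dist p q₁ = 1 ∧ dist p q₂ = 1) : T.card ≤ 2 := by
  by_contra hlt
  push Not at hlt
  obtain ⟨p₁, h₁, p₂, h₂, p₃, h₃, h12, h13, h23⟩ := Finset.two_lt_card.1 hlt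
  obtain ⟨a1, a2, a3⟩ := hT p₁ h₁
  obtain ⟨b1, b2, b3⟩ := hT p₂ h₂
  obtain ⟨c1, c2, c3⟩ := hT p₃ h₃
  rcases three_unit_spheres_subsingleton₃ hq₁ hq₂ hne a1 a2 a3 b1 b2 b3 c1 c2 c3 with h | h | h
  · exact h12 h
  · exact h13 h
  · exact h23 h

open scoped Classical in
/-- **STAR SHARING ≤ 2 (cluster form).**  In any configuration `X`, two distinct balls `q₁, q₂` touching a ball `x` have at most two
common contacts among the contacts of `x`.  For two exact 13-clusters `{qᵢ} ∪ D(qᵢ)` containing `x` as a dozen ball, with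
non-adjacent centres, the intersection of their 5-stars at `x` consists of such common contacts, hence has at most two balls. -/
theorem card_common_star_le_two (X : Finset (EuclideanSpace ℝ (Fin 3))) {x q₁ q₂ : (EuclideanSpace ℝ (Fin 3))} (hq₁ : dist x q₁ = 1) (hq₂ : dist x q₂ = 1) (hne : q₁ ≠ q₂) :
    (X.filter fun p => dist x p = 1 ∧ dist q₁ p = 1 ∧ dist q₂ p = 1).card ≤ 2 := by
  refine card_touching_three_le_two (x := x) (by rwa [dist_comm]) (by rwa [dist_comm]) hne _ fun p hp => ?_
  obtain ⟨-, h1, h2, h3⟩ := Finset.mem_filter.1 hp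
  exact ⟨by rwa [dist_comm], by rwa [dist_comm], by rwa [dist_comm]⟩

end StarSharing

end Summit.Ventures.Crystal3D.Theorems

end
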